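import Literature.Geometry.Kaehler.ComplexTorusIntegralLefschetzFormsDiscriminant
import HarnessLib

/-!
# The discriminants of the integral Lefschetz forms, intrinsic forms: any presentation of the polarised torus,
# THE type of a Riemann form, principal polarisations

Layer `Literature/Geometry/Kaehler`, namespace `Literature.Geometry.Kaehler.ComplexTorus`; lane `lit-hodgefound` (Track 2
foundations library), seat p09, generation 42, row g42-#6. THEOREMS ONLY (0 definitions); no named fact, net debt 0. Sequel of
g41-#1 `ComplexTorusIntegralLefschetzFormsDiscriminant`: there the Gram determinants of the integral Lefschetz forms
`(x, y) ↦ ⟨x, γ_{g−k} ∧ y⟩` on `Hᵏ(X, ℤ)` (`k = 1, 2, 3`, `γ_q = θ^{∧q}/(q!·d₁⋯d_q)` the minimal classes of g36-#1) were computed for a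
SYMPLECTIC presentation of the polarised torus (`IsSymplecticEnum`), with the value formulas also for any presentation
(`IsPolarizationType`). This file completes the basis-free side:

* §1 ANY PRESENTATION `X = E/Φ(ℤ^ι)` of a polarised torus of type `(d₁, …, d_g)` (`IsPolarizationType Φ η d`), every `ℤ`-basis of `Hᵏ(X, ℤ)`:
  the unimodularity criteria — degree one: `|det| = 1 ⟺ d₁ = ⋯ = d_g`; degree two: `⟺ g = 2`; degree three: `⟺ g = 3` — the every-type
  value in degree three, and existence forms producing the minimal class together with its integer Gram matrix;
* §2 THE TYPE of a Riemann form (`IsRiemannForm.polarizationType`, the elementary divisors of `E|_Λ`, no choice of basis anywhere):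
  `|det (⟨b_i, γ_{g−1} ∧ b_{i'}⟩)| = (∏_a d_g(η)/d_a(η))²` on `H¹(X, ℤ)`, unimodular iff the type of `η` is constant;
  `|det (⟨b_i, γ_{g−2} ∧ b_{i'}⟩)| = (g−1)·∏_{i ≤ g−2} ((d_{g−1}/d_i)(d_g/d_i))^{2g−1}` on `H²(X, ℤ)`, unimodular iff `g = 2`; degree three
  unimodular iff `g = 3`;
* §3 PRINCIPAL POLARISATIONS (`IsPrincipalPolarization Φ η`, type `(1, …, 1)`, minimal classes `θ^{∧q}/q!`): the Lefschetz form of degree one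
  is UNIMODULAR on every `ℤ`-basis of `H¹(X, ℤ)` (Poincaré duality composed with `θ^{g−1}/(g−1)! ∧ (−) : H¹(X, ℤ) ⥲ H^{2g−1}(X, ℤ)`), the form of
  degree two has `|disc| = g − 1` (so `2` on a principally polarised threefold, `H²(X, ℤ) ≅ ℤ^{15}` with `(x, y) ↦ ∫ θ ∧ x ∧ y`), the form of
  degree three has `|disc| = (g−2)^{2g}`.

Sources (the statements being made precise over `ℤ`): Lange 2023 §6.2.4 (PDF p. 310: "the cup product pairing … yields the Poincaré duality
`Hᵖ(X, ℤ) ⥲ H^{2g−p}(X, ℤ)^*`"), §1.5.1 (PDF p. 51: the type = elementary divisors of `E|_Λ`), §2.1.1 (principal = type `(1, …, 1)`), §2.5.3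
Thm. 2.5.16 / Cor. 2.5.17 (PDF p. 135: `θ^{∧q}` on a symplectic basis), §5.4.1 Thm. 5.4.1 and (5.22) (PDF p. 275: hard Lefschetz over `ℂ`);
Conway–Sloane 1999 Ch. 2 §2.4 (PDF p. 162: "`Λ*/Λ` has order `det Λ`"); Voisin 2002 §7.1.2 (PDF p. 134 L31: the Lefschetz operator on integral
cohomology), §7.2.2 (PDF p. 142 L10); Benoist–Debarre 2023 §1 (p. 3: the minimal class `θ^c/c!` of a principally polarised abelian variety).

Method: every statement is the corresponding `IsPolarizationType` statement of g41-#1 (or §1 here), specialised along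
`IsRiemannForm.isPolarizationType_polarizationType.comp_cast` (THE type) and `IsPrincipalPolarization.exists_type_eq_one` (all `d_i = 1`);
§1 itself is g41-#1 §1 (`[Hˡ(X, ℤ) : L(Hᵏ(X, ℤ))] = |det (⟨b_i, L b_j⟩)|`, the Poincaré-dual basis) with the basis-free index theorems of
g40-#5/#6/#7 (`IsPolarizationType.map_wedge_integralForms_{one,two,three…}_eq_integralForms_iff_of_eq_content_smul`,
`IsPolarizationType.relIndex_map_wedge_integralForms_three_hardLefschetz_of_eq_content_smul`).

## References

* [cite: Lange2023AbelianVarietiesComplex, §6.2.4 (PDF p. 310); §1.5.1 (PDF p. 51); §2.1.1; §2.5.3 Thm. 2.5.16 and Cor. 2.5.17 (PDF p. 135);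
  §5.4.1 Thm. 5.4.1 and (5.22) (PDF p. 275); §4.2 (PDF p. 204)]
* [cite: ConwaySloane1999, Ch. 2 §2.4 (PDF p. 162)]
* [cite: VoisinHodgeI2002, §7.1.2 (PDF p. 134 L31); §7.2.2 (PDF p. 142 L10)]
* [cite: BenoistDebarre2023SmoothSubvarietiesJacobians, §1 (p. 3)]
-/

noncomputable section

open Module Function
open Literature.LinearAlgebra.Alternating

namespace Literature.Geometry.Kaehler.ComplexTorus

/-! ## §0 Private helpers -/

section Helpers

variable {ι : Type*} [Fintype ι] [DecidableEq ι] {E : Type*} [NormedAddCommGroup E] [NormedSpace ℂ E]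
  {g : ℕ} {η : E [⋀^Fin 2]→L[ℝ] ℝ} {d : Fin g → ℕ}

/-- An injective additive map kills only `0` on any subgroup. [folklore] -/
private theorem forall_mem_eq_zero_of_injective₅₆ {A B : Type*} [AddCommGroup A] [AddCommGroup B] (L : A →+ B)
    (hL : Injective L) (S : AddSubgroup A) : ∀ x ∈ S, L x = 0 → x = 0 :=
  fun _ _ hx ↦ hL (hx.trans L.map_zero.symm)

/-- Any presentation: the divided class `γ_q` (`θ^{∧q} = (q!·d₁⋯d_q)·γ_q`) is integral — it is THE minimal class, which is unique.
[cite: Lange2023AbelianVarietiesComplex, §2.5.3 Thm. 2.5.16 (PDF p. 135); §1.5.1 (PDF p. 51)] -/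
private theorem IsPolarizationType.mem_integralForms_of_eq_content_smul₅₆ {Φ : (ι → ℝ) ≃L[ℝ] E} (hd : IsPolarizationType Φ η d)
    (hη : IsRiemannForm Φ η) {q : ℕ} (hq : q ≤ g) {γ : E [⋀^Fin (2 * q)]→L[ℝ] ℂ}
    (hγ : wedgePow (ofRealForm η) q = ((q.factorial * ∏ i, d (Fin.castLE hq i) : ℕ) : ℂ) • γ) : γ ∈ integralForms Φ (2 * q) := by
  obtain ⟨Φ', hΛ, hs⟩ := hd.exists_isSymplecticEnum Φ
  obtain ⟨γ', hγ'Z, hγ'⟩ := hd.exists_mem_integralForms_wedgePow_eq_content_smul hq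
  rwa [hs.eq_of_wedgePow_eq_content_smul Φ' (hη.of_range_latticeVec_subset hΛ.le) hq hγ hγ']

end Helpers

/-! ## §1 Any presentation of a polarised torus of type `(d₁, …, d_g)`: unimodularity criteria, degree three, existence forms -/

section AnyPresentationDegreeTwo

variable {ι : Type*} [Fintype ι] [DecidableEq ι] {E : Type*} [NormedAddCommGroup E] [NormedSpace ℂ E]
  {j n : ℕ} {η : E [⋀^Fin 2]→L[ℝ] ℝ} {d : Fin (j + 2) → ℕ}

/-- **Any presentation: the Lefschetz form of degree two is unimodular iff `g = 2`** (`g = j + 2`): for a polarised torus `X = E/Φ(ℤ^ι)` of type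
`(d₁, …, d_g)` presented by ANY lattice basis, the minimal class `γ = γ_{g−2}` and every `ℤ`-basis `b` of `H²(X, ℤ)`,
`|det (⟨b_i, γ ∧ b_{i'}⟩)| = 1 ⟺ j = 0` (for `g ≥ 3` the discriminant is a multiple of `g − 1`).
[cite: Lange2023AbelianVarietiesComplex, §6.2.4 (PDF p. 310); §1.5.1 (PDF p. 51); §5.4.1 (5.22) (PDF p. 275)] [cite: ConwaySloane1999, Ch. 2 §2.4 (PDF p. 162)] [cite: VoisinHodgeI2002, §7.1.2 (PDF p. 134 L31)] -/
theorem IsPolarizationType.natAbs_det_poincarePairing_wedge_two_eq_one_iff_of_eq_content_smul {Φ : (ι → ℝ) ≃L[ℝ] E}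
    (hd : IsPolarizationType Φ η d) (hη : IsRiemannForm Φ η) (hle : j ≤ j + 2) {γ : E [⋀^Fin (2 * j)]→L[ℝ] ℂ}
    (hγ : wedgePow (ofRealForm η) j = ((j.factorial * ∏ i : Fin j, d (Fin.castLE hle i) : ℕ) : ℂ) • γ)
    (e : Fin n ≃ ι) (hn : 2 + (2 * j + 2) = n) {m : Type*} [Fintype m] [DecidableEq m] (b : Basis m ℤ ↥(integralForms Φ 2))
    (G : Matrix m m ℤ) (hG : ∀ i i', (G i i' : ℂ) = poincarePairing Φ e hn (b i : E [⋀^Fin 2]→L[ℝ] ℂ) (γ.wedge (b i'))) :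
    G.det.natAbs = 1 ↔ j = 0 := by
  have hγZ := hd.mem_integralForms_of_eq_content_smul₅₆ hη hle hγ
  have hle₂ : (integralForms Φ 2).map (AddMonoidHom.mk' (fun x : E [⋀^Fin 2]→L[ℝ] ℂ ↦ γ.wedge x)
      (ContinuousAlternatingMap.wedge_add_right _)) ≤ integralForms Φ (2 * j + 2) := by
    rintro _ ⟨x, hx, rfl⟩
    exact wedge_mem_integralForms Φ hγZ hx
  rw [← relIndex_map_integralForms_eq_natAbs_det Φ e hn b _ hle₂ (forall_mem_eq_zero_of_injective₅₆ _
    (wedge_injective_of_wedgePow_eq_smul Φ ((finCongr (by omega)).trans e) hη hγ) _) G hG,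
    AddSubgroup.relIndex_eq_one, ← hd.map_wedge_integralForms_two_eq_integralForms_iff_of_eq_content_smul hη hle hγ]
  exact ⟨fun hle' ↦ le_antisymm hle₂ hle', fun heq ↦ heq.ge⟩

/-- **Existence form, any presentation, degree two**: the polarised torus carries the integral Hodge class `γ_{g−2}`
(`θ^{∧(g−2)} = ((g−2)!·d₁⋯d_{g−2})·γ_{g−2}`), and on every `ℤ`-basis `b` of `H²(X, ℤ)` its Gram matrix `(⟨b_i, γ_{g−2} ∧ b_{i'}⟩)` is an integer
matrix with `|det| = (g−1)·∏_{i ≤ g−2} ((d_{g−1}/d_i)(d_g/d_i))^{2g−1}`, equal to `1` iff `g = 2` (`g = j + 2`).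
[cite: Lange2023AbelianVarietiesComplex, §6.2.4 (PDF p. 310); §2.5.3 Thm. 2.5.16 and Cor. 2.5.17 (PDF p. 135); §5.4.1 (5.22) (PDF p. 275)] [cite: ConwaySloane1999, Ch. 2 §2.4 (PDF p. 162)] [cite: BenoistDebarre2023SmoothSubvarietiesJacobians, §1 (p. 3)] -/
theorem IsPolarizationType.exists_minimalHodgeClass_natAbs_det_poincarePairing_wedge_two {Φ : (ι → ℝ) ≃L[ℝ] E}
    (hd : IsPolarizationType Φ η d) (hη : IsRiemannForm Φ η) (hle : j ≤ j + 2)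
    (e : Fin n ≃ ι) (hn : 2 + (2 * j + 2) = n) {m : Type*} [Fintype m] [DecidableEq m] (b : Basis m ℤ ↥(integralForms Φ 2)) :
    ∃ γ ∈ integralHodgeClasses Φ j, wedgePow (ofRealForm η) j = ((j.factorial * ∏ i : Fin j, d (Fin.castLE hle i) : ℕ) : ℂ) • γ ∧
      ∃ G : Matrix m m ℤ, (∀ i i', (G i i' : ℂ) = poincarePairing Φ e hn (b i : E [⋀^Fin 2]→L[ℝ] ℂ) (γ.wedge (b i'))) ∧
        G.det.natAbs = (j + 1) * (∏ i : Fin j, (d (Fin.last j).castSucc / d (Fin.castLE hle i)) *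
          (d (Fin.last (j + 1)) / d (Fin.castLE hle i))) ^ (2 * j + 3) ∧ (G.det.natAbs = 1 ↔ j = 0) := by
  obtain ⟨γ, hγZ, hγ, G, hG, hdet⟩ := hd.exists_minimalClass_natAbs_det_poincarePairing_wedge_two hη hle e hn b
  exact ⟨γ, hd.mem_integralHodgeClasses_of_wedgePow_eq_content_smul hη hle hγZ hγ, hγ, G, hG, hdet,
    hd.natAbs_det_poincarePairing_wedge_two_eq_one_iff_of_eq_content_smul hη hle hγ e hn b G hG⟩

end AnyPresentationDegreeTwo

section AnyPresentationDegreeOne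

variable {ι : Type*} [Fintype ι] [DecidableEq ι] {E : Type*} [NormedAddCommGroup E] [NormedSpace ℂ E]
  {j n : ℕ} {η : E [⋀^Fin 2]→L[ℝ] ℝ} {d : Fin (j + 2) → ℕ}

/-- **Any presentation: the Lefschetz form of degree one is unimodular iff the type is constant** (`g = j + 2`): for the minimal class
`m = γ_{g−1}` (`θ^{∧(g−1)} = ((g−1)!·d₁⋯d_{g−1})·m`) and every `ℤ`-basis `b` of `H¹(X, ℤ)`, `|det (⟨b_i, m ∧ b_{i'}⟩)| = 1 ⟺ d₁ = ⋯ = d_g`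
(the value is `(∏_a d_g/d_a)²`). [cite: Lange2023AbelianVarietiesComplex, §6.2.4 (PDF p. 310); §4.2 (PDF p. 204); §5.4.1 (5.22) (PDF p. 275); §1.5.1 (PDF p. 51)] [cite: ConwaySloane1999, Ch. 2 §2.4 (PDF p. 162)] [cite: VoisinHodgeI2002, §7.2.2 (PDF p. 142 L10)] -/
theorem IsPolarizationType.natAbs_det_poincarePairing_wedge_one_eq_one_iff_of_eq_content_smul {Φ : (ι → ℝ) ≃L[ℝ] E}
    (hd : IsPolarizationType Φ η d) (hη : IsRiemannForm Φ η) (hle₁ : j + 1 ≤ j + 2) {m : E [⋀^Fin (2 * (j + 1))]→L[ℝ] ℂ}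
    (hm : wedgePow (ofRealForm η) (j + 1) = (((j + 1).factorial * ∏ i : Fin (j + 1), d (Fin.castLE hle₁ i) : ℕ) : ℂ) • m)
    (e : Fin n ≃ ι) (hn : 1 + (2 * j + 3) = n) {κ : Type*} [Fintype κ] [DecidableEq κ] (b : Basis κ ℤ ↥(integralForms Φ 1))
    (G : Matrix κ κ ℤ) (hG : ∀ i i', (G i i' : ℂ) =
      poincarePairing Φ e hn (b i : E [⋀^Fin 1]→L[ℝ] ℂ) (m.wedge (b i' : E [⋀^Fin 1]→L[ℝ] ℂ) : E [⋀^Fin (2 * j + 3)]→L[ℝ] ℂ)) :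
    G.det.natAbs = 1 ↔ ∀ i, d i = d 0 := by
  have hmZ := hd.mem_integralForms_of_eq_content_smul₅₆ hη hle₁ hm
  have hle₂ : (integralForms Φ 1).map (AddMonoidHom.mk'
      (fun x : E [⋀^Fin 1]→L[ℝ] ℂ ↦ (m.wedge x : E [⋀^Fin (2 * j + 3)]→L[ℝ] ℂ)) (ContinuousAlternatingMap.wedge_add_right _)) ≤
      integralForms Φ (2 * j + 3) := by
    rintro _ ⟨x, hx, rfl⟩
    exact wedge_mem_integralForms Φ hmZ hx
  rw [← relIndex_map_integralForms_eq_natAbs_det Φ e hn b _ hle₂ (forall_mem_eq_zero_of_injective₅₆ _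
    (wedge_injective_one_of_wedgePow_eq_smul Φ ((finCongr (by omega)).trans e) hη hm) _) G hG,
    AddSubgroup.relIndex_eq_one, ← hd.map_wedge_integralForms_one_eq_integralForms_iff_of_eq_content_smul hη hle₁ hm]
  exact ⟨fun hle' ↦ le_antisymm hle₂ hle', fun heq ↦ heq.ge⟩

/-- **Existence form, any presentation, degree one**: the polarised torus carries the integral Hodge class `γ_{g−1}`
(`θ^{∧(g−1)} = ((g−1)!·d₁⋯d_{g−1})·γ_{g−1}`), and on every `ℤ`-basis `b` of `H¹(X, ℤ)` the Gram matrix `(⟨b_i, γ_{g−1} ∧ b_{i'}⟩)` is an integer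
matrix with `|det| = (∏_{a=1}^{g} d_g/d_a)²`, equal to `1` iff `d₁ = ⋯ = d_g` (`g = j + 2`).
[cite: Lange2023AbelianVarietiesComplex, §6.2.4 (PDF p. 310); §2.5.3 Thm. 2.5.16 and Cor. 2.5.17 (PDF p. 135); §5.4.1 (5.22) (PDF p. 275); §1.5.1 (PDF p. 51)] [cite: ConwaySloane1999, Ch. 2 §2.4 (PDF p. 162)] [cite: VoisinHodgeI2002, §7.2.2 (PDF p. 142 L10)] -/
theorem IsPolarizationType.exists_minimalHodgeClass_natAbs_det_poincarePairing_wedge_one {Φ : (ι → ℝ) ≃L[ℝ] E}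
    (hd : IsPolarizationType Φ η d) (hη : IsRiemannForm Φ η) (hle₁ : j + 1 ≤ j + 2)
    (e : Fin n ≃ ι) (hn : 1 + (2 * j + 3) = n) {κ : Type*} [Fintype κ] [DecidableEq κ] (b : Basis κ ℤ ↥(integralForms Φ 1)) :
    ∃ m ∈ integralHodgeClasses Φ (j + 1),
      wedgePow (ofRealForm η) (j + 1) = (((j + 1).factorial * ∏ i : Fin (j + 1), d (Fin.castLE hle₁ i) : ℕ) : ℂ) • m ∧
      ∃ G : Matrix κ κ ℤ, (∀ i i', (G i i' : ℂ) =
          poincarePairing Φ e hn (b i : E [⋀^Fin 1]→L[ℝ] ℂ) (m.wedge (b i' : E [⋀^Fin 1]→L[ℝ] ℂ) : E [⋀^Fin (2 * j + 3)]→L[ℝ] ℂ)) ∧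
        G.det.natAbs = (∏ a : Fin (j + 2), (d (Fin.last (j + 1)) / d a)) ^ 2 ∧ (G.det.natAbs = 1 ↔ ∀ i, d i = d 0) := by
  obtain ⟨m, hmZ, hm⟩ := hd.exists_mem_integralForms_wedgePow_eq_content_smul hle₁
  have hle₂ : (integralForms Φ 1).map (AddMonoidHom.mk'
      (fun x : E [⋀^Fin 1]→L[ℝ] ℂ ↦ (m.wedge x : E [⋀^Fin (2 * j + 3)]→L[ℝ] ℂ)) (ContinuousAlternatingMap.wedge_add_right _)) ≤
      integralForms Φ (2 * j + 3) := by
    rintro _ ⟨x, hx, rfl⟩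
    exact wedge_mem_integralForms Φ hmZ hx
  obtain ⟨G, hG⟩ := exists_matrix_eq_poincarePairing_map Φ e hn b _ hle₂
  exact ⟨m, hd.mem_integralHodgeClasses_of_wedgePow_eq_content_smul hη hle₁ hmZ hm, hm, G, hG,
    hd.natAbs_det_poincarePairing_wedge_one_of_eq_content_smul hη hle₁ hm e hn b G hG,
    hd.natAbs_det_poincarePairing_wedge_one_eq_one_iff_of_eq_content_smul hη hle₁ hm e hn b G hG⟩

end AnyPresentationDegreeOne

section AnyPresentationDegreeThree

variable {ι : Type*} [Fintype ι] [DecidableEq ι] {E : Type*} [NormedAddCommGroup E] [NormedSpace ℂ E]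
  {j n : ℕ} {η : E [⋀^Fin 2]→L[ℝ] ℝ} {d : Fin (j + 3) → ℕ}

/-- **Any presentation, every type: the discriminant of the Lefschetz form of degree three** (`g = j + 3`, minimal class `γ = γ_{g−3}`,
`θ^{∧(g−3)} = ((g−3)!·d₁⋯d_{g−3})·γ`, ANY `ℤ`-basis `b` of `H³(X, ℤ)`, any lattice basis): `|det (⟨b_i, γ ∧ b_{i'}⟩)| = [H^{2g−3}(X, ℤ) : γ_{g−3} ∧ H³(X, ℤ)]`,
the index of g40-#7 (product over the `8·C(g,3)` free words of `∏_{ν∉{a,b,c}} d_ν/(d₁⋯d_{g−3})`, times the product over the `2g` letters `x` of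
`(g−2)·∏_{i ≤ g−3} (d_{g−2}/d_i)(d_{g−1}/d_i)·(d_g/d_{a(x)})^{g−3}`). [cite: Lange2023AbelianVarietiesComplex, §6.2.4 (PDF p. 310); §1.5.1 (PDF p. 51); §5.4.1 Thm. 5.4.1 and (5.22) (PDF p. 275); §2.5.3 Cor. 2.5.17 (PDF p. 135)] [cite: ConwaySloane1999, Ch. 2 §2.4 (PDF p. 162)] [cite: VoisinHodgeI2002, §7.1.2 (PDF p. 134 L31)] -/
theorem IsPolarizationType.natAbs_det_poincarePairing_wedge_three_of_eq_content_smul {Φ : (ι → ℝ) ≃L[ℝ] E}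
    (hd : IsPolarizationType Φ η d) (hη : IsRiemannForm Φ η) (hle : j ≤ j + 3) {γ : E [⋀^Fin (2 * j)]→L[ℝ] ℂ}
    (hγ : wedgePow (ofRealForm η) j = ((j.factorial * ∏ i : Fin j, d (Fin.castLE hle i) : ℕ) : ℂ) • γ)
    (e : Fin n ≃ ι) (hn : 3 + (2 * j + 3) = n) {m : Type*} [Fintype m] [DecidableEq m] (b : Basis m ℤ ↥(integralForms Φ 3))
    (G : Matrix m m ℤ) (hG : ∀ i i', (G i i' : ℂ) = poincarePairing Φ e hn (b i : E [⋀^Fin 3]→L[ℝ] ℂ) (γ.wedge (b i'))) :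
    G.det.natAbs =
      (∏ u : {u : Fin 3 → Fin (j + 3) ⊕ Fin (j + 3) //
            Sum.elim id id (u 0) < Sum.elim id id (u 1) ∧ Sum.elim id id (u 1) < Sum.elim id id (u 2)},
          (∏ ν ∈ (Finset.univ.image fun m ↦ Sum.elim id id (u.1 m))ᶜ, d ν) / ∏ i : Fin j, d (Fin.castLE hle i)) *
        ∏ x : Fin (j + 3) ⊕ Fin (j + 3), ((j + 1) *
          ((∏ i : Fin j, (d (Fin.last j).castSucc.castSucc / d (Fin.castLE hle i)) *
              (d (Fin.last (j + 1)).castSucc / d (Fin.castLE hle i))) *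
            (d (Fin.last (j + 2)) / d (Sum.elim id id x)) ^ j)) := by
  have hγZ := hd.mem_integralForms_of_eq_content_smul₅₆ hη hle hγ
  have hle₂ : (integralForms Φ 3).map (AddMonoidHom.mk' (fun x : E [⋀^Fin 3]→L[ℝ] ℂ ↦ γ.wedge x)
      (ContinuousAlternatingMap.wedge_add_right _)) ≤ integralForms Φ (2 * j + 3) := by
    rintro _ ⟨x, hx, rfl⟩
    exact wedge_mem_integralForms Φ hγZ hx
  rw [← hd.relIndex_map_wedge_integralForms_three_hardLefschetz_of_eq_content_smul hη hle hγ]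
  exact (relIndex_map_integralForms_eq_natAbs_det Φ e hn b _ hle₂ (forall_mem_eq_zero_of_injective₅₆ _
    (wedge_injective_three_of_wedgePow_eq_smul Φ ((finCongr (by omega)).trans e) hη hγ) _) G hG).symm

/-- **Any presentation: the Lefschetz form of degree three is unimodular iff `g = 3`** (`g = j + 3`; for `g ≥ 4` the discriminant is a multiple
of `(g−2)^{2g}`). [cite: Lange2023AbelianVarietiesComplex, §6.2.4 (PDF p. 310); §1.5.1 (PDF p. 51); §5.4.1 (5.22) (PDF p. 275)] [cite: ConwaySloane1999, Ch. 2 §2.4 (PDF p. 162)] [cite: VoisinHodgeI2002, §7.1.2 (PDF p. 134 L31)] -/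
theorem IsPolarizationType.natAbs_det_poincarePairing_wedge_three_eq_one_iff_of_eq_content_smul {Φ : (ι → ℝ) ≃L[ℝ] E}
    (hd : IsPolarizationType Φ η d) (hη : IsRiemannForm Φ η) (hle : j ≤ j + 3) {γ : E [⋀^Fin (2 * j)]→L[ℝ] ℂ}
    (hγ : wedgePow (ofRealForm η) j = ((j.factorial * ∏ i : Fin j, d (Fin.castLE hle i) : ℕ) : ℂ) • γ)
    (e : Fin n ≃ ι) (hn : 3 + (2 * j + 3) = n) {m : Type*} [Fintype m] [DecidableEq m] (b : Basis m ℤ ↥(integralForms Φ 3))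
    (G : Matrix m m ℤ) (hG : ∀ i i', (G i i' : ℂ) = poincarePairing Φ e hn (b i : E [⋀^Fin 3]→L[ℝ] ℂ) (γ.wedge (b i'))) :
    G.det.natAbs = 1 ↔ j = 0 := by
  have hγZ := hd.mem_integralForms_of_eq_content_smul₅₆ hη hle hγ
  have hle₂ : (integralForms Φ 3).map (AddMonoidHom.mk' (fun x : E [⋀^Fin 3]→L[ℝ] ℂ ↦ γ.wedge x)
      (ContinuousAlternatingMap.wedge_add_right _)) ≤ integralForms Φ (2 * j + 3) := by
    rintro _ ⟨x, hx, rfl⟩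
    exact wedge_mem_integralForms Φ hγZ hx
  rw [← relIndex_map_integralForms_eq_natAbs_det Φ e hn b _ hle₂ (forall_mem_eq_zero_of_injective₅₆ _
    (wedge_injective_three_of_wedgePow_eq_smul Φ ((finCongr (by omega)).trans e) hη hγ) _) G hG,
    AddSubgroup.relIndex_eq_one, ← hd.map_wedge_integralForms_three_hardLefschetz_eq_integralForms_iff_of_eq_content_smul hη hle hγ]
  exact ⟨fun hle' ↦ le_antisymm hle₂ hle', fun heq ↦ heq.ge⟩

/-- **Existence form, any presentation, degree three**: the polarised torus carries the integral Hodge class `γ_{g−3}`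
(`θ^{∧(g−3)} = ((g−3)!·d₁⋯d_{g−3})·γ_{g−3}`), and on every `ℤ`-basis `b` of `H³(X, ℤ)` the Gram matrix `(⟨b_i, γ_{g−3} ∧ b_{i'}⟩)` is an
integer matrix, unimodular iff `g = 3` (`g = j + 3`). [cite: Lange2023AbelianVarietiesComplex, §6.2.4 (PDF p. 310); §2.5.3 Thm. 2.5.16 and Cor. 2.5.17 (PDF p. 135); §5.4.1 (5.22) (PDF p. 275)] [cite: ConwaySloane1999, Ch. 2 §2.4 (PDF p. 162)] [cite: BenoistDebarre2023SmoothSubvarietiesJacobians, §1 (p. 3)] -/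
theorem IsPolarizationType.exists_minimalHodgeClass_natAbs_det_poincarePairing_wedge_three_eq_one_iff {Φ : (ι → ℝ) ≃L[ℝ] E}
    (hd : IsPolarizationType Φ η d) (hη : IsRiemannForm Φ η) (hle : j ≤ j + 3)
    (e : Fin n ≃ ι) (hn : 3 + (2 * j + 3) = n) {m : Type*} [Fintype m] [DecidableEq m] (b : Basis m ℤ ↥(integralForms Φ 3)) :
    ∃ γ ∈ integralHodgeClasses Φ j, wedgePow (ofRealForm η) j = ((j.factorial * ∏ i : Fin j, d (Fin.castLE hle i) : ℕ) : ℂ) • γ ∧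
      ∃ G : Matrix m m ℤ, (∀ i i', (G i i' : ℂ) = poincarePairing Φ e hn (b i : E [⋀^Fin 3]→L[ℝ] ℂ) (γ.wedge (b i'))) ∧
        (G.det.natAbs = 1 ↔ j = 0) := by
  obtain ⟨γ, hγZ, hγ⟩ := hd.exists_mem_integralForms_wedgePow_eq_content_smul hle
  have hle₂ : (integralForms Φ 3).map (AddMonoidHom.mk' (fun x : E [⋀^Fin 3]→L[ℝ] ℂ ↦ γ.wedge x)
      (ContinuousAlternatingMap.wedge_add_right _)) ≤ integralForms Φ (2 * j + 3) := by
    rintro _ ⟨x, hx, rfl⟩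
    exact wedge_mem_integralForms Φ hγZ hx
  obtain ⟨G, hG⟩ := exists_matrix_eq_poincarePairing_map Φ e hn b _ hle₂
  exact ⟨γ, hd.mem_integralHodgeClasses_of_wedgePow_eq_content_smul hη hle hγZ hγ, hγ, G, hG,
    hd.natAbs_det_poincarePairing_wedge_three_eq_one_iff_of_eq_content_smul hη hle hγ e hn b G hG⟩

end AnyPresentationDegreeThree

/-! ## §2 THE type of a Riemann form (`IsRiemannForm.polarizationType`) -/

section TheType

variable {ι : Type*} [Fintype ι] [DecidableEq ι] {E : Type*} [NormedAddCommGroup E] [NormedSpace ℂ E]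
  {j n : ℕ} {η : E [⋀^Fin 2]→L[ℝ] ℝ}

/-- **THE type: `|det (⟨b_i, γ_{g−1} ∧ b_{i'}⟩)| = (∏_{a=1}^{g} d_g(η)/d_a(η))²`** for a Riemann form `η` on ANY complex torus `X = E/Φ(ℤ^ι)`
(`|ι| = 2g`, `g = j + 2`, `(d₁(η), …, d_g(η)) = IsRiemannForm.polarizationType` the elementary divisors of `E|_Λ`), the minimal class
`m = γ_{g−1}` and every `ℤ`-basis `b` of `H¹(X, ℤ)`. [cite: Lange2023AbelianVarietiesComplex, §6.2.4 (PDF p. 310); §1.5.1 (PDF p. 51); §5.4.1 (5.22) (PDF p. 275)] [cite: ConwaySloane1999, Ch. 2 §2.4 (PDF p. 162)] [cite: VoisinHodgeI2002, §7.2.2 (PDF p. 142 L10)] -/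
theorem IsRiemannForm.natAbs_det_poincarePairing_wedge_one_of_eq_content_smul {Φ : (ι → ℝ) ≃L[ℝ] E} (hη : IsRiemannForm Φ η)
    (hj : j + 2 = Fintype.card ι / 2) (hle₁ : j + 1 ≤ j + 2) {m : E [⋀^Fin (2 * (j + 1))]→L[ℝ] ℂ}
    (hm : wedgePow (ofRealForm η) (j + 1) =
      (((j + 1).factorial * ∏ i : Fin (j + 1), hη.polarizationType (Fin.cast hj (Fin.castLE hle₁ i)) : ℕ) : ℂ) • m)
    (e : Fin n ≃ ι) (hn : 1 + (2 * j + 3) = n) {κ : Type*} [Fintype κ] [DecidableEq κ] (b : Basis κ ℤ ↥(integralForms Φ 1))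
    (G : Matrix κ κ ℤ) (hG : ∀ i i', (G i i' : ℂ) =
      poincarePairing Φ e hn (b i : E [⋀^Fin 1]→L[ℝ] ℂ) (m.wedge (b i' : E [⋀^Fin 1]→L[ℝ] ℂ) : E [⋀^Fin (2 * j + 3)]→L[ℝ] ℂ)) :
    G.det.natAbs = (∏ a : Fin (j + 2),
      (hη.polarizationType (Fin.cast hj (Fin.last (j + 1))) / hη.polarizationType (Fin.cast hj a))) ^ 2 :=
  (hη.isPolarizationType_polarizationType.comp_cast hj).natAbs_det_poincarePairing_wedge_one_of_eq_content_smul hη hle₁ hm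
    e hn b G hG

/-- **THE type: the Lefschetz form of degree one is unimodular on `H¹(X, ℤ)` iff the type of `η` is constant** (`d₁(η) = ⋯ = d_g(η)`, i.e.
`η` is an integer multiple of a principal polarisation; `|ι| = 2g`, `g = j + 2`). [cite: Lange2023AbelianVarietiesComplex, §6.2.4 (PDF p. 310); §1.5.1 (PDF p. 51); §4.2 (PDF p. 204); §5.4.1 (5.22) (PDF p. 275)] [cite: VoisinHodgeI2002, §7.2.2 (PDF p. 142 L10)] -/
theorem IsRiemannForm.natAbs_det_poincarePairing_wedge_one_eq_one_iff_of_eq_content_smul {Φ : (ι → ℝ) ≃L[ℝ] E}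
    (hη : IsRiemannForm Φ η) (hj : j + 2 = Fintype.card ι / 2) (hle₁ : j + 1 ≤ j + 2) {m : E [⋀^Fin (2 * (j + 1))]→L[ℝ] ℂ}
    (hm : wedgePow (ofRealForm η) (j + 1) =
      (((j + 1).factorial * ∏ i : Fin (j + 1), hη.polarizationType (Fin.cast hj (Fin.castLE hle₁ i)) : ℕ) : ℂ) • m)
    (e : Fin n ≃ ι) (hn : 1 + (2 * j + 3) = n) {κ : Type*} [Fintype κ] [DecidableEq κ] (b : Basis κ ℤ ↥(integralForms Φ 1))
    (G : Matrix κ κ ℤ) (hG : ∀ i i', (G i i' : ℂ) =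
      poincarePairing Φ e hn (b i : E [⋀^Fin 1]→L[ℝ] ℂ) (m.wedge (b i' : E [⋀^Fin 1]→L[ℝ] ℂ) : E [⋀^Fin (2 * j + 3)]→L[ℝ] ℂ)) :
    G.det.natAbs = 1 ↔ ∀ i i', hη.polarizationType i = hη.polarizationType i' := by
  rw [(hη.isPolarizationType_polarizationType.comp_cast hj).natAbs_det_poincarePairing_wedge_one_eq_one_iff_of_eq_content_smul
    hη hle₁ hm e hn b G hG]
  exact ⟨fun h i i' ↦ (h (Fin.cast hj.symm i)).trans (h (Fin.cast hj.symm i')).symm, fun h i ↦ h _ _⟩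

/-- **Existence form, THE type, degree one**: every Riemann form `η` on `X = E/Φ(ℤ^ι)` (`|ι| = 2g`, `g = j + 2`) carries the integral Hodge
class `γ_{g−1}` (`θ^{∧(g−1)} = ((g−1)!·d₁(η)⋯d_{g−1}(η))·γ_{g−1}`), and on every `ℤ`-basis `b` of `H¹(X, ℤ)` the Gram matrix
`(⟨b_i, γ_{g−1} ∧ b_{i'}⟩)` is an integer matrix with `|det| = (∏_a d_g(η)/d_a(η))²`, equal to `1` iff the type of `η` is constant.
[cite: Lange2023AbelianVarietiesComplex, §6.2.4 (PDF p. 310); §1.5.1 (PDF p. 51); §2.5.3 Thm. 2.5.16 and Cor. 2.5.17 (PDF p. 135); §5.4.1 (5.22) (PDF p. 275)] [cite: ConwaySloane1999, Ch. 2 §2.4 (PDF p. 162)] [cite: VoisinHodgeI2002, §7.2.2 (PDF p. 142 L10)] -/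
theorem IsRiemannForm.exists_minimalHodgeClass_natAbs_det_poincarePairing_wedge_one {Φ : (ι → ℝ) ≃L[ℝ] E}
    (hη : IsRiemannForm Φ η) (hj : j + 2 = Fintype.card ι / 2) (hle₁ : j + 1 ≤ j + 2)
    (e : Fin n ≃ ι) (hn : 1 + (2 * j + 3) = n) {κ : Type*} [Fintype κ] [DecidableEq κ] (b : Basis κ ℤ ↥(integralForms Φ 1)) :
    ∃ m ∈ integralHodgeClasses Φ (j + 1),
      wedgePow (ofRealForm η) (j + 1) =
        (((j + 1).factorial * ∏ i : Fin (j + 1), hη.polarizationType (Fin.cast hj (Fin.castLE hle₁ i)) : ℕ) : ℂ) • m ∧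
      ∃ G : Matrix κ κ ℤ, (∀ i i', (G i i' : ℂ) =
          poincarePairing Φ e hn (b i : E [⋀^Fin 1]→L[ℝ] ℂ) (m.wedge (b i' : E [⋀^Fin 1]→L[ℝ] ℂ) : E [⋀^Fin (2 * j + 3)]→L[ℝ] ℂ)) ∧
        G.det.natAbs = (∏ a : Fin (j + 2),
          (hη.polarizationType (Fin.cast hj (Fin.last (j + 1))) / hη.polarizationType (Fin.cast hj a))) ^ 2 ∧
        (G.det.natAbs = 1 ↔ ∀ i i', hη.polarizationType i = hη.polarizationType i') := by
  obtain ⟨m, hmH, hm, G, hG, hdet, -⟩ :=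
    (hη.isPolarizationType_polarizationType.comp_cast hj).exists_minimalHodgeClass_natAbs_det_poincarePairing_wedge_one hη hle₁ e hn b
  exact ⟨m, hmH, hm, G, hG, hdet, hη.natAbs_det_poincarePairing_wedge_one_eq_one_iff_of_eq_content_smul hj hle₁ hm e hn b G hG⟩

/-- **THE type: `|det (⟨b_i, γ_{g−2} ∧ b_{i'}⟩)| = (g−1)·∏_{i ≤ g−2} ((d_{g−1}(η)/d_i(η))(d_g(η)/d_i(η)))^{2g−1}`** on every `ℤ`-basis `b` of `H²(X, ℤ)`
(`|ι| = 2g`, `g = j + 2`, minimal class `γ = γ_{g−2}`). [cite: Lange2023AbelianVarietiesComplex, §6.2.4 (PDF p. 310); §1.5.1 (PDF p. 51); §5.4.1 (5.22) (PDF p. 275)] [cite: ConwaySloane1999, Ch. 2 §2.4 (PDF p. 162)] [cite: VoisinHodgeI2002, §7.1.2 (PDF p. 134 L31)] -/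
theorem IsRiemannForm.natAbs_det_poincarePairing_wedge_two_of_eq_content_smul {Φ : (ι → ℝ) ≃L[ℝ] E} (hη : IsRiemannForm Φ η)
    (hj : j + 2 = Fintype.card ι / 2) (hle : j ≤ j + 2) {γ : E [⋀^Fin (2 * j)]→L[ℝ] ℂ}
    (hγ : wedgePow (ofRealForm η) j =
      ((j.factorial * ∏ i : Fin j, hη.polarizationType (Fin.cast hj (Fin.castLE hle i)) : ℕ) : ℂ) • γ)
    (e : Fin n ≃ ι) (hn : 2 + (2 * j + 2) = n) {m : Type*} [Fintype m] [DecidableEq m] (b : Basis m ℤ ↥(integralForms Φ 2))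
    (G : Matrix m m ℤ) (hG : ∀ i i', (G i i' : ℂ) = poincarePairing Φ e hn (b i : E [⋀^Fin 2]→L[ℝ] ℂ) (γ.wedge (b i'))) :
    G.det.natAbs = (j + 1) *
      (∏ i : Fin j, (hη.polarizationType (Fin.cast hj (Fin.last j).castSucc) / hη.polarizationType (Fin.cast hj (Fin.castLE hle i))) *
        (hη.polarizationType (Fin.cast hj (Fin.last (j + 1))) / hη.polarizationType (Fin.cast hj (Fin.castLE hle i)))) ^ (2 * j + 3) :=
  (hη.isPolarizationType_polarizationType.comp_cast hj).natAbs_det_poincarePairing_wedge_two_of_eq_content_smul hη hle hγ e hn b G hG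

/-- **THE type: the Lefschetz form of degree two is unimodular on `H²(X, ℤ)` iff `g = 2`** (`|ι| = 2g`, `g = j + 2`), whatever the type of
`η`. [cite: Lange2023AbelianVarietiesComplex, §6.2.4 (PDF p. 310); §1.5.1 (PDF p. 51); §5.4.1 (5.22) (PDF p. 275)] [cite: VoisinHodgeI2002, §7.1.2 (PDF p. 134 L31)] -/
theorem IsRiemannForm.natAbs_det_poincarePairing_wedge_two_eq_one_iff_of_eq_content_smul {Φ : (ι → ℝ) ≃L[ℝ] E}
    (hη : IsRiemannForm Φ η) (hj : j + 2 = Fintype.card ι / 2) (hle : j ≤ j + 2) {γ : E [⋀^Fin (2 * j)]→L[ℝ] ℂ}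
    (hγ : wedgePow (ofRealForm η) j =
      ((j.factorial * ∏ i : Fin j, hη.polarizationType (Fin.cast hj (Fin.castLE hle i)) : ℕ) : ℂ) • γ)
    (e : Fin n ≃ ι) (hn : 2 + (2 * j + 2) = n) {m : Type*} [Fintype m] [DecidableEq m] (b : Basis m ℤ ↥(integralForms Φ 2))
    (G : Matrix m m ℤ) (hG : ∀ i i', (G i i' : ℂ) = poincarePairing Φ e hn (b i : E [⋀^Fin 2]→L[ℝ] ℂ) (γ.wedge (b i'))) :
    G.det.natAbs = 1 ↔ j = 0 :=
  (hη.isPolarizationType_polarizationType.comp_cast hj).natAbs_det_poincarePairing_wedge_two_eq_one_iff_of_eq_content_smul hη hle hγ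
    e hn b G hG

/-- **Existence form, THE type, degree two**: every Riemann form `η` on `X` (`|ι| = 2g`, `g = j + 2`) carries the integral Hodge class `γ_{g−2}`,
whose Gram matrix `(⟨b_i, γ_{g−2} ∧ b_{i'}⟩)` on any `ℤ`-basis `b` of `H²(X, ℤ)` is an integer matrix with
`|det| = (g−1)·∏_{i ≤ g−2} ((d_{g−1}(η)/d_i(η))(d_g(η)/d_i(η)))^{2g−1}`, equal to `1` iff `g = 2`. [cite: Lange2023AbelianVarietiesComplex, §6.2.4 (PDF p. 310); §1.5.1 (PDF p. 51); §2.5.3 Thm. 2.5.16 and Cor. 2.5.17 (PDF p. 135); §5.4.1 (5.22) (PDF p. 275)] [cite: ConwaySloane1999, Ch. 2 §2.4 (PDF p. 162)] -/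
theorem IsRiemannForm.exists_minimalHodgeClass_natAbs_det_poincarePairing_wedge_two {Φ : (ι → ℝ) ≃L[ℝ] E}
    (hη : IsRiemannForm Φ η) (hj : j + 2 = Fintype.card ι / 2) (hle : j ≤ j + 2)
    (e : Fin n ≃ ι) (hn : 2 + (2 * j + 2) = n) {m : Type*} [Fintype m] [DecidableEq m] (b : Basis m ℤ ↥(integralForms Φ 2)) :
    ∃ γ ∈ integralHodgeClasses Φ j,
      wedgePow (ofRealForm η) j = ((j.factorial * ∏ i : Fin j, hη.polarizationType (Fin.cast hj (Fin.castLE hle i)) : ℕ) : ℂ) • γ ∧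
      ∃ G : Matrix m m ℤ, (∀ i i', (G i i' : ℂ) = poincarePairing Φ e hn (b i : E [⋀^Fin 2]→L[ℝ] ℂ) (γ.wedge (b i'))) ∧
        G.det.natAbs = (j + 1) *
          (∏ i : Fin j, (hη.polarizationType (Fin.cast hj (Fin.last j).castSucc) / hη.polarizationType (Fin.cast hj (Fin.castLE hle i))) *
            (hη.polarizationType (Fin.cast hj (Fin.last (j + 1))) / hη.polarizationType (Fin.cast hj (Fin.castLE hle i)))) ^ (2 * j + 3) ∧
        (G.det.natAbs = 1 ↔ j = 0) :=
  (hη.isPolarizationType_polarizationType.comp_cast hj).exists_minimalHodgeClass_natAbs_det_poincarePairing_wedge_two hη hle e hn b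

/-- **THE type: the Lefschetz form of degree three is unimodular on `H³(X, ℤ)` iff `g = 3`** (`|ι| = 2g`, `g = j + 3`, minimal class
`γ = γ_{g−3}`), whatever the type of `η`. [cite: Lange2023AbelianVarietiesComplex, §6.2.4 (PDF p. 310); §1.5.1 (PDF p. 51); §5.4.1 (5.22) (PDF p. 275)] [cite: VoisinHodgeI2002, §7.1.2 (PDF p. 134 L31)] -/
theorem IsRiemannForm.natAbs_det_poincarePairing_wedge_three_eq_one_iff_of_eq_content_smul {Φ : (ι → ℝ) ≃L[ℝ] E}
    (hη : IsRiemannForm Φ η) (hj : j + 3 = Fintype.card ι / 2) (hle : j ≤ j + 3) {γ : E [⋀^Fin (2 * j)]→L[ℝ] ℂ}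
    (hγ : wedgePow (ofRealForm η) j =
      ((j.factorial * ∏ i : Fin j, hη.polarizationType (Fin.cast hj (Fin.castLE hle i)) : ℕ) : ℂ) • γ)
    (e : Fin n ≃ ι) (hn : 3 + (2 * j + 3) = n) {m : Type*} [Fintype m] [DecidableEq m] (b : Basis m ℤ ↥(integralForms Φ 3))
    (G : Matrix m m ℤ) (hG : ∀ i i', (G i i' : ℂ) = poincarePairing Φ e hn (b i : E [⋀^Fin 3]→L[ℝ] ℂ) (γ.wedge (b i'))) :
    G.det.natAbs = 1 ↔ j = 0 :=
  (hη.isPolarizationType_polarizationType.comp_cast hj).natAbs_det_poincarePairing_wedge_three_eq_one_iff_of_eq_content_smul hη hle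
    hγ e hn b G hG

end TheType

/-! ## §3 Principal polarisations: type `(1, …, 1)`, minimal classes `θ^{∧q}/q!` -/

section Principal

variable {ι : Type*} [Fintype ι] [DecidableEq ι] {E : Type*} [NormedAddCommGroup E] [NormedSpace ℂ E]
  {j n : ℕ} {η : E [⋀^Fin 2]→L[ℝ] ℝ}

omit [DecidableEq ι] in
/-- The genus read off an ordering `e : Fin n ≃ ι` of the lattice basis with `n = 2g'`: any type has length `g'`.
[cite: Lange2023AbelianVarietiesComplex, §1.5.1 (PDF p. 51)] -/
private theorem IsPolarizationType.eq_of_equiv₅₆ {Φ : (ι → ℝ) ≃L[ℝ] E} {g g' : ℕ} {d : Fin g → ℕ} (hd : IsPolarizationType Φ η d)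
    (e : Fin n ≃ ι) (hn : 2 * g' = n) : g' = g := by
  have h₁ := hd.card_eq
  have h₂ := Fintype.card_congr e
  rw [Fintype.card_fin] at h₂
  omega

/-- **Principal polarisation: the Lefschetz form of degree one is unimodular** — for a principally polarised complex torus `X = E/Φ(ℤ^ι)` of
dimension `g = j + 2`, the minimal class `m = θ^{∧(g−1)}/(g−1)!` and EVERY `ℤ`-basis `b` of `H¹(X, ℤ)`, the integer matrix `(⟨b_i, m ∧ b_{i'}⟩)` has
determinant `±1`: Poincaré duality `H^{2g−1}(X, ℤ) ≅ H¹(X, ℤ)^*` composed with the isomorphism `m ∧ (−) : H¹(X, ℤ) ⥲ H^{2g−1}(X, ℤ)` over `ℤ`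
(type `(1, …, 1)`). [cite: Lange2023AbelianVarietiesComplex, §6.2.4 (PDF p. 310); §2.1.1; §5.4.1 (5.22) (PDF p. 275)] [cite: ConwaySloane1999, Ch. 2 §2.4 (PDF p. 162)] [cite: BenoistDebarre2023SmoothSubvarietiesJacobians, §1 (p. 3)] -/
theorem IsPrincipalPolarization.natAbs_det_poincarePairing_wedge_one_of_eq_factorial_smul {Φ : (ι → ℝ) ≃L[ℝ] E}
    (hp : IsPrincipalPolarization Φ η) {m : E [⋀^Fin (2 * (j + 1))]→L[ℝ] ℂ}
    (hm : wedgePow (ofRealForm η) (j + 1) = ((j + 1).factorial : ℂ) • m)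
    (e : Fin n ≃ ι) (hn : 1 + (2 * j + 3) = n) {κ : Type*} [Fintype κ] [DecidableEq κ] (b : Basis κ ℤ ↥(integralForms Φ 1))
    (G : Matrix κ κ ℤ) (hG : ∀ i i', (G i i' : ℂ) =
      poincarePairing Φ e hn (b i : E [⋀^Fin 1]→L[ℝ] ℂ) (m.wedge (b i' : E [⋀^Fin 1]→L[ℝ] ℂ) : E [⋀^Fin (2 * j + 3)]→L[ℝ] ℂ)) :
    G.det.natAbs = 1 := by
  obtain ⟨g, d', hd', h1⟩ := hp.exists_type_eq_one
  have hg : j + 2 = g := hd'.eq_of_equiv₅₆ e (by omega)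
  have hd := hd'.comp_cast hg
  have hle₁ : j + 1 ≤ j + 2 := Nat.le_succ _
  have hm' : wedgePow (ofRealForm η) (j + 1) =
      (((j + 1).factorial * ∏ i : Fin (j + 1), d' (Fin.cast hg (Fin.castLE hle₁ i)) : ℕ) : ℂ) • m := by
    simp only [h1, Finset.prod_const_one, mul_one]
    exact hm
  exact (hd.natAbs_det_poincarePairing_wedge_one_eq_one_iff_of_eq_content_smul hp.isRiemannForm hle₁ hm' e hn b G hG).2
    fun i ↦ (h1 _).trans (h1 _).symm

/-- **Existence form, principal polarisation, degree one**: a principally polarised torus of dimension `g = j + 2` carries the integral Hodge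
class `θ^{∧(g−1)}/(g−1)!`, and its Gram matrix `(⟨b_i, θ^{∧(g−1)}/(g−1)! ∧ b_{i'}⟩)` on any `ℤ`-basis `b` of `H¹(X, ℤ)` is a unimodular integer matrix.
[cite: Lange2023AbelianVarietiesComplex, §6.2.4 (PDF p. 310); §2.1.1; §2.5.3 Thm. 2.5.16 (PDF p. 135); §5.4.1 (5.22) (PDF p. 275)] [cite: BenoistDebarre2023SmoothSubvarietiesJacobians, §1 (p. 3)] -/
theorem IsPrincipalPolarization.exists_minimalHodgeClass_natAbs_det_poincarePairing_wedge_one_eq_one {Φ : (ι → ℝ) ≃L[ℝ] E}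
    (hp : IsPrincipalPolarization Φ η) (e : Fin n ≃ ι) (hn : 1 + (2 * j + 3) = n) {κ : Type*} [Fintype κ] [DecidableEq κ]
    (b : Basis κ ℤ ↥(integralForms Φ 1)) :
    ∃ m ∈ integralHodgeClasses Φ (j + 1), wedgePow (ofRealForm η) (j + 1) = ((j + 1).factorial : ℂ) • m ∧
      ∃ G : Matrix κ κ ℤ, (∀ i i', (G i i' : ℂ) =
          poincarePairing Φ e hn (b i : E [⋀^Fin 1]→L[ℝ] ℂ) (m.wedge (b i' : E [⋀^Fin 1]→L[ℝ] ℂ) : E [⋀^Fin (2 * j + 3)]→L[ℝ] ℂ)) ∧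
        G.det.natAbs = 1 := by
  obtain ⟨g, d', hd', h1⟩ := hp.exists_type_eq_one
  have hg : j + 2 = g := hd'.eq_of_equiv₅₆ e (by omega)
  have hle₁ : j + 1 ≤ j + 2 := Nat.le_succ _
  obtain ⟨m, hmH, hm, G, hG, -, hiff⟩ :=
    (hd'.comp_cast hg).exists_minimalHodgeClass_natAbs_det_poincarePairing_wedge_one hp.isRiemannForm hle₁ e hn b
  simp only [h1, Finset.prod_const_one, mul_one] at hm
  exact ⟨m, hmH, hm, G, hG, hiff.2 fun i ↦ (h1 _).trans (h1 _).symm⟩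

/-- **Principal polarisation: the Lefschetz form of degree two has `|disc| = g − 1`** — for a principally polarised complex torus of dimension
`g = j + 2`, the minimal class `γ = θ^{∧(g−2)}/(g−2)!` and every `ℤ`-basis `b` of `H²(X, ℤ)`: `|det (⟨b_i, γ ∧ b_{i'}⟩)| = g − 1`; so the form is
unimodular on an abelian surface, and `(x, y) ↦ ∫_X θ ∧ x ∧ y` on `H²(X, ℤ) ≅ ℤ^{15}` of a principally polarised threefold has discriminant `±2`.
[cite: Lange2023AbelianVarietiesComplex, §6.2.4 (PDF p. 310); §2.1.1; §5.4.1 (5.22) (PDF p. 275)] [cite: ConwaySloane1999, Ch. 2 §2.4 (PDF p. 162)] [cite: VoisinHodgeI2002, §7.1.2 (PDF p. 134 L31)] -/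
theorem IsPrincipalPolarization.natAbs_det_poincarePairing_wedge_two_of_eq_factorial_smul {Φ : (ι → ℝ) ≃L[ℝ] E}
    (hp : IsPrincipalPolarization Φ η) {γ : E [⋀^Fin (2 * j)]→L[ℝ] ℂ} (hγ : wedgePow (ofRealForm η) j = (j.factorial : ℂ) • γ)
    (e : Fin n ≃ ι) (hn : 2 + (2 * j + 2) = n) {m : Type*} [Fintype m] [DecidableEq m] (b : Basis m ℤ ↥(integralForms Φ 2))
    (G : Matrix m m ℤ) (hG : ∀ i i', (G i i' : ℂ) = poincarePairing Φ e hn (b i : E [⋀^Fin 2]→L[ℝ] ℂ) (γ.wedge (b i'))) :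
    G.det.natAbs = j + 1 := by
  obtain ⟨g, d', hd', h1⟩ := hp.exists_type_eq_one
  have hg : j + 2 = g := hd'.eq_of_equiv₅₆ e (by omega)
  have hd := hd'.comp_cast hg
  have hle : j ≤ j + 2 := Nat.le_add_right j 2
  have hγ' : wedgePow (ofRealForm η) j =
      ((j.factorial * ∏ i : Fin j, d' (Fin.cast hg (Fin.castLE hle i)) : ℕ) : ℂ) • γ := by
    simp only [h1, Finset.prod_const_one, mul_one]
    exact hγ
  exact hd.natAbs_det_poincarePairing_wedge_two_of_eq_content_smul_of_forall_eq hp.isRiemannForm hle hγ'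
    (fun i ↦ (h1 _).trans (h1 _).symm) e hn b G hG

/-- **Existence form, principal polarisation, degree two**: a principally polarised torus of dimension `g = j + 2` carries the integral Hodge
class `θ^{∧(g−2)}/(g−2)!`, whose Gram matrix on any `ℤ`-basis of `H²(X, ℤ)` is an integer matrix with `|det| = g − 1`.
[cite: Lange2023AbelianVarietiesComplex, §6.2.4 (PDF p. 310); §2.1.1; §2.5.3 Thm. 2.5.16 (PDF p. 135); §5.4.1 (5.22) (PDF p. 275)] [cite: BenoistDebarre2023SmoothSubvarietiesJacobians, §1 (p. 3)] -/
theorem IsPrincipalPolarization.exists_minimalHodgeClass_natAbs_det_poincarePairing_wedge_two {Φ : (ι → ℝ) ≃L[ℝ] E}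
    (hp : IsPrincipalPolarization Φ η) (e : Fin n ≃ ι) (hn : 2 + (2 * j + 2) = n) {m : Type*} [Fintype m] [DecidableEq m]
    (b : Basis m ℤ ↥(integralForms Φ 2)) :
    ∃ γ ∈ integralHodgeClasses Φ j, wedgePow (ofRealForm η) j = (j.factorial : ℂ) • γ ∧
      ∃ G : Matrix m m ℤ, (∀ i i', (G i i' : ℂ) = poincarePairing Φ e hn (b i : E [⋀^Fin 2]→L[ℝ] ℂ) (γ.wedge (b i'))) ∧
        G.det.natAbs = j + 1 := by
  obtain ⟨g, d', hd', h1⟩ := hp.exists_type_eq_one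
  have hg : j + 2 = g := hd'.eq_of_equiv₅₆ e (by omega)
  obtain ⟨γ, hγH, hγ, G, hG, -, -⟩ :=
    (hd'.comp_cast hg).exists_minimalHodgeClass_natAbs_det_poincarePairing_wedge_two hp.isRiemannForm (Nat.le_add_right j 2) e hn b
  simp only [h1, Finset.prod_const_one, mul_one] at hγ
  exact ⟨γ, hγH, hγ, G, hG, hp.natAbs_det_poincarePairing_wedge_two_of_eq_factorial_smul hγ e hn b G hG⟩

/-- **Principal polarisation: the Lefschetz form of degree three has `|disc| = (g−2)^{2g}`** — for a principally polarised complex torus of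
dimension `g = j + 3`, the minimal class `γ = θ^{∧(g−3)}/(g−3)!` and every `ℤ`-basis `b` of `H³(X, ℤ)`: `|det (⟨b_i, γ ∧ b_{i'}⟩)| = (g−2)^{2g}`;
unimodular on a threefold, `2^8` for `(x, y) ↦ ∫_X x ∧ θ ∧ y` on `H³(X, ℤ) ≅ ℤ^{56}` of a principally polarised fourfold.
[cite: Lange2023AbelianVarietiesComplex, §6.2.4 (PDF p. 310); §2.1.1; §5.4.1 (5.22) (PDF p. 275)] [cite: ConwaySloane1999, Ch. 2 §2.4 (PDF p. 162)] [cite: VoisinHodgeI2002, §7.1.2 (PDF p. 134 L31)] -/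
theorem IsPrincipalPolarization.natAbs_det_poincarePairing_wedge_three_of_eq_factorial_smul {Φ : (ι → ℝ) ≃L[ℝ] E}
    (hp : IsPrincipalPolarization Φ η) {γ : E [⋀^Fin (2 * j)]→L[ℝ] ℂ} (hγ : wedgePow (ofRealForm η) j = (j.factorial : ℂ) • γ)
    (e : Fin n ≃ ι) (hn : 3 + (2 * j + 3) = n) {m : Type*} [Fintype m] [DecidableEq m] (b : Basis m ℤ ↥(integralForms Φ 3))
    (G : Matrix m m ℤ) (hG : ∀ i i', (G i i' : ℂ) = poincarePairing Φ e hn (b i : E [⋀^Fin 3]→L[ℝ] ℂ) (γ.wedge (b i'))) :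
    G.det.natAbs = (j + 1) ^ (2 * (j + 3)) := by
  obtain ⟨g, d', hd', h1⟩ := hp.exists_type_eq_one
  have hg : j + 3 = g := hd'.eq_of_equiv₅₆ e (by omega)
  have hd := hd'.comp_cast hg
  have hle : j ≤ j + 3 := Nat.le_add_right j 3
  have hγ' : wedgePow (ofRealForm η) j =
      ((j.factorial * ∏ i : Fin j, d' (Fin.cast hg (Fin.castLE hle i)) : ℕ) : ℂ) • γ := by
    simp only [h1, Finset.prod_const_one, mul_one]
    exact hγ
  exact hd.natAbs_det_poincarePairing_wedge_three_of_eq_content_smul_of_forall_eq hp.isRiemannForm hle hγ'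
    (fun i ↦ (h1 _).trans (h1 _).symm) e hn b G hG

/-- **Existence form, principal polarisation, degree three**: a principally polarised torus of dimension `g = j + 3` carries the integral
Hodge class `θ^{∧(g−3)}/(g−3)!`, whose Gram matrix on any `ℤ`-basis of `H³(X, ℤ)` is an integer matrix with `|det| = (g−2)^{2g}`.
[cite: Lange2023AbelianVarietiesComplex, §6.2.4 (PDF p. 310); §2.1.1; §2.5.3 Thm. 2.5.16 (PDF p. 135); §5.4.1 (5.22) (PDF p. 275)] [cite: BenoistDebarre2023SmoothSubvarietiesJacobians, §1 (p. 3)] -/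
theorem IsPrincipalPolarization.exists_minimalHodgeClass_natAbs_det_poincarePairing_wedge_three {Φ : (ι → ℝ) ≃L[ℝ] E}
    (hp : IsPrincipalPolarization Φ η) (e : Fin n ≃ ι) (hn : 3 + (2 * j + 3) = n) {m : Type*} [Fintype m] [DecidableEq m]
    (b : Basis m ℤ ↥(integralForms Φ 3)) :
    ∃ γ ∈ integralHodgeClasses Φ j, wedgePow (ofRealForm η) j = (j.factorial : ℂ) • γ ∧
      ∃ G : Matrix m m ℤ, (∀ i i', (G i i' : ℂ) = poincarePairing Φ e hn (b i : E [⋀^Fin 3]→L[ℝ] ℂ) (γ.wedge (b i'))) ∧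
        G.det.natAbs = (j + 1) ^ (2 * (j + 3)) := by
  obtain ⟨g, d', hd', h1⟩ := hp.exists_type_eq_one
  have hg : j + 3 = g := hd'.eq_of_equiv₅₆ e (by omega)
  obtain ⟨γ, hγH, hγ, G, hG, -⟩ :=
    (hd'.comp_cast hg).exists_minimalHodgeClass_natAbs_det_poincarePairing_wedge_three_eq_one_iff hp.isRiemannForm
      (Nat.le_add_right j 3) e hn b
  simp only [h1, Finset.prod_const_one, mul_one] at hγ
  exact ⟨γ, hγH, hγ, G, hG, hp.natAbs_det_poincarePairing_wedge_three_of_eq_factorial_smul hγ e hn b G hG⟩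

end Principal

end Literature.Geometry.Kaehler.ComplexTorus
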